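import Summits.HodgeConjecture.HodgeConjecture.Theorems.R90S4CartanNormMap          -- ★ p863295 (this seat): `T̃ = Cent(γ)` abelian, ε-stable, `N : T̃ → T` onto, `Cent(N t) = Cent(γ)`; brings ★ `R90S4TwistedNormMapLocal` (`IsEpsNormPair`, `epsNorm_epsLoc_mul_mul_inv`, `epsLoc_apply_coe`), ★ `R90S4TwistedNormMap` (`isEpsConj_symm`, `isEpsConj_trans`), ★ `R90S4TwistedTransferDefs` (`IsEpsRegularAt`, `IsStablyEpsConjAt`)
import Summits.HodgeConjecture.HodgeConjecture.Theorems.R90S4EpsCanonicalAtPoint     -- ★ p863195 (this seat): `isEpsConj_of_eqvGen_epsConjModRel_bot`, `isEpsConj_out_mk` (the classes `EpsConjClassesMod ε ⊥` read through `IsEpsConj`)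
import HarnessLib

/-!
# R90-TF · S4 «Ch. 13.1–2», T-WIF road, Layer A — THE NORM FIBRE OF A CARTAN: over a regular `γ ∈ G_v` with `T̃ = Cent_{G̃_v}(γ)`, the ε-classes with norm
# `γ` are EXACTLY the `(1−ε)T̃`-cosets in `N⁻¹(γ) ⊆ T̃` (Rogawski 1990, §3.11 Prop. 3.11.1–2 pp. 34–35; §12.5 p. 186)

Cell `hodgecm-mathlib`, crux H413 (`stmt-HodgeConjecture-24833`, lane `--supports … --as helper`), route of record `HCCMUnconditional` (no route verbs;
count-neutral).  Programme R90-TF, section S4 = [Rogawski1990] Ch. 13.1–13.2; seat R90-C131-p03 (g2); FILE α of the HEADS SHEET `R90/R90-C131-p03/g2/HEADS-TWIF-tube.md`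
(S4 dealer K2E2-plan (g7), S4-R18 (3)(b)): heads A1 + A2 + A3 — the structural algebra under the ε-twisted tube map `Ψ_T (x, t) = x t ε(x)⁻¹` of the twisted Weyl
integration formula B1 «T-WIF» (`IsTwistedWeylMeasure`, ★ p862981; its (W-NP) consumer ★ p863508).  THEOREMS ONLY — no `def`, no instance, no notation, no named-fact
hypothesis, no `sorry`; ★-only imports (two S4 `Theorems` files of this seat), never `Lines`.

HONEST LABEL: HC_CM is proved only modulo the 7 printed citations (2 remaining named inputs: hLiu418 = stmt-HodgeConjecture-24832, h413 =
stmt-HodgeConjecture-24833) until rung 0 closes.  Group algebra over `L ⊗ L⁺_v`; discharges no socket by itself — T-WIF's analytic part (the twisted Jacobian,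
«compatible measures») and (NORM-RAT) are untouched (REL ≠ ★ ≠ BUILT).

## The mathematics

Setting: the S4 carriers `G_v = U(Φ)(L⁺_v) ⊂ G̃_v = GL₃(L ⊗ L⁺_v)` (`Φ` hermitian where said), `ε = ε_v = epsLoc L Φ v` (involutive, ★ `twistLocal_twistLocal_cm`),
`N δ = δ ε(δ)` (★ `epsNorm`); `γ ∈ G_v` REGULAR, `T̃ := Cent_{G̃_v}(γ)` (abelian and ε-stable, ★ p863295), `C_T := {s ε(s)⁻¹ : s ∈ T̃}` («`(1−ε)T̃`»), and the NORM
FIBRE `S_γ := {t ∈ G̃_v : N t = γ}`.  PRINT [Rogawski1990 §3.11 pp. 34–35]: Prop. 3.11.1 (b) «there exists `δ ∈ G̃` such that `N(δ) = γ` … and `G̃_{δε} = G_γ`»,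
(c) the ε-classes within a stable ε-class `𝒪_{ε-st}(δ)` are parametrised by `𝒟_ε(δ∕F) = Ker(H¹(F, G_{δε}) → H¹(F, G̃))`; [§12.5 p. 186] «`1 → Z̃T̃ᴺ → T̃ → Z∖T → 1` is
exact» and the torus variable of T-WIF runs over `T̃` modulo `T̃ᴺ = Ker N`.  HERE, with no cohomology:
* §1 (A1) for commuting `s, t`: `t` is ε-conjugate to `t · s ε(s)⁻¹` (witness `s`), and `N(s ε(s)⁻¹) = 1` — the ε-class of `t ∈ T̃` only depends on `t · C_T ⊆ t · T̃ᴺ`.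
* §2 (A2) FIBRE LEMMA: if `y t ε(y)⁻¹ = t′` with `t ∈ T̃` ε-regular then `N t′ = y (N t) y⁻¹`; if moreover `N t = N t′` then `y ∈ T̃` and `t′ = t · y ε(y)⁻¹ ∈ t C_T`
  (`Cent(N t) = Cent(γ) = T̃`, ★ `centralizer_eq_centralizer_of_isRegularElt`); and if `t′ ∈ T̃` too, `y` NORMALISES `T̃` (`Cent(N t′) = T̃` as well).
* §3 (A3) THE NORM FIBRE: `S_γ ⊆ T̃` (`t⁻¹ (N t) t = ε(N t) = N t` as `ε γ = γ`); every `δ` with `γ ∈ 𝒩(δ)` (★ `IsEpsNormPair`) is ε-conjugate INTO `S_γ` (conjugate `N δ`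
  onto `γ` by `y`, take `y δ ε(y)⁻¹`, ★ `epsNorm_epsLoc_mul_mul_inv`); two points of `S_γ` are ε-conjugate iff they differ by an element of `C_T`.
* §4 ON CLASSES (`EpsConjClassesMod ε ⊥`, the index type of ★ `stableEpsOrbitalIntegral_eq_finsum`): for any `δ₀` with `γ ∈ 𝒩(δ₀)` (e.g. `sec₀ γ`),
  `IsStablyEpsConjAt … δ₀ δ ↔ γ ∈ 𝒩(δ)`, and **`{c | IsStablyEpsConjAt … δ₀ (out c)} = ⟦·⟧ '' S_γ`** with `⟦t⟧ = ⟦t′⟧ ↔ t′ ∈ t · C_T` on `S_γ` — the index set of the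
  stable ε-orbital integral at `sec₀ γ` IS the norm fibre modulo `(1−ε)T̃` (print's `𝒟_ε`, here `≅ T̃ᴺ ∕ (1−ε)T̃`-torsor; its finiteness (FIN) is the sequel).

[cite: Rogawski1990, §3.11 Prop. 3.11.1 (b)(c), Prop. 3.11.2 pp. 34–35; §12.5 p. 186; §4.10 (4.10.1) p. 57; §1.4 p. 4]
-/

set_option autoImplicit false
-- the mandated namespace repeats the single-problem summit's segment (`HodgeConjecture.HodgeConjecture`)
set_option linter.dupNamespace false

noncomputable section

open scoped NumberField Matrix MatrixGroups

namespace Summit.HodgeConjecture.HodgeConjecture.R90.S4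

open Literature.NumberTheory.Rogawski1990 Literature.NumberTheory.Rogawski1990.Ch4Sec10
open Literature.NumberTheory.Automorphic
open IsDedekindDomain NumberField

section NormFibre

variable (L : Type) [Field L] [NumberField L] [IsCMField L] (Φ : GL (Fin 3) L) (v : HeightOneSpectrum (𝓞 ↥(maximalRealSubfield L)))

/-! ## §1 (A1) ε-conjugation by a commuting element: `t ∼_ε t · s ε(s)⁻¹`, and `N(s ε(s)⁻¹) = 1` -/

variable {L Φ v} in
/-- **The ε-class of `t` contains `t · s ε(s)⁻¹` for every `s` commuting with `t`** (witness `s`: `s t ε(s)⁻¹ = t s ε(s)⁻¹`) — on the abelian `T̃` the ε-orbit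
through `t` meets `T̃` in (at least) the coset `t · (1−ε)T̃`. [cite: Rogawski1990, §1.4 p. 4; §3.11 p. 35] -/
theorem isEpsConj_mul_mul_epsLoc_inv_of_commute {t s : GtLoc L v} (h : s * t = t * s) :
    IsEpsConj (epsLoc L Φ v) t (t * (s * (epsLoc L Φ v s)⁻¹)) :=
  ⟨s, by rw [h, mul_assoc]⟩

variable {L Φ v} in
/-- **`N(s ε(s)⁻¹) = 1`** (hermitian `Φ`, so `ε ∘ ε = 1`): `(1−ε)T̃ ⊆ T̃ᴺ = Ker N`. [cite: Rogawski1990, §12.5 p. 186; §3.11 p. 35] -/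
theorem epsNorm_mul_epsLoc_inv
    (hΦ : ((Φ : GL (Fin 3) L) : Matrix (Fin 3) (Fin 3) L)ᵀ.map (IsCMField.complexConj L) = (Φ : Matrix (Fin 3) (Fin 3) L)) (s : GtLoc L v) :
    epsNorm (epsLoc L Φ v) (s * (epsLoc L Φ v s)⁻¹) = 1 := by
  have hε : epsLoc L Φ v (epsLoc L Φ v s) = s := twistLocal_twistLocal_cm L 3 Φ hΦ v s
  show s * (epsLoc L Φ v s)⁻¹ * epsLoc L Φ v (s * (epsLoc L Φ v s)⁻¹) = 1
  rw [map_mul, map_inv, hε]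
  group

variable {L Φ v} in
/-- `ε(s ε(s)⁻¹) = (s ε(s)⁻¹)⁻¹` (hermitian `Φ`): the elements of `(1−ε)T̃` are ε-ANTI-fixed (★ `epsNorm_eq_one_iff`). [cite: Rogawski1990, §12.5 p. 186] -/
theorem epsLoc_mul_epsLoc_inv
    (hΦ : ((Φ : GL (Fin 3) L) : Matrix (Fin 3) (Fin 3) L)ᵀ.map (IsCMField.complexConj L) = (Φ : Matrix (Fin 3) (Fin 3) L)) (s : GtLoc L v) :
    epsLoc L Φ v (s * (epsLoc L Φ v s)⁻¹) = (s * (epsLoc L Φ v s)⁻¹)⁻¹ :=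
  (epsNorm_eq_one_iff L Φ v (s * (epsLoc L Φ v s)⁻¹)).1 (epsNorm_mul_epsLoc_inv hΦ s)

/-! ## §2 (A2) The fibre lemma: ε-conjugate points of `T̃` with the same norm differ by `(1−ε)T̃` -/

variable {L Φ v} in
/-- **`N(y t ε(y)⁻¹) = y (N t) y⁻¹`** read on an ε-conjugacy `y t ε(y)⁻¹ = t′`: the norms of ε-conjugate elements are conjugate BY THE SAME `y`
(★ `epsNorm_epsLoc_mul_mul_inv`). [cite: Rogawski1990, §3.11 p. 34] -/
theorem epsNorm_eq_conj_of_epsConj_eq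
    (hΦ : ((Φ : GL (Fin 3) L) : Matrix (Fin 3) (Fin 3) L)ᵀ.map (IsCMField.complexConj L) = (Φ : Matrix (Fin 3) (Fin 3) L)) {y t t' : GtLoc L v}
    (h : y * t * (epsLoc L Φ v y)⁻¹ = t') : epsNorm (epsLoc L Φ v) t' = y * epsNorm (epsLoc L Φ v) t * y⁻¹ := by
  rw [← h]
  exact epsNorm_epsLoc_mul_mul_inv hΦ y t

variable {L Φ v} in
/-- **FIBRE LEMMA (same norm)**: for `γ ∈ G_v` regular, `t ∈ T̃ = Cent(γ)` ε-regular and `y t ε(y)⁻¹ = t′` with `N t = N t′`: `y ∈ T̃` — `y` centralises `N t`, and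
`Cent(N t) = Cent(γ)` (★ `centralizer_eq_centralizer_of_isRegularElt`: `N t ∈ T̃` is regular). [cite: Rogawski1990, §3.11 Prop. 3.11.2 pp. 34–35; §12.5 p. 186] -/
theorem mem_centralizer_of_epsConj_eq_of_epsNorm_eq
    (hΦ : ((Φ : GL (Fin 3) L) : Matrix (Fin 3) (Fin 3) L)ᵀ.map (IsCMField.complexConj L) = (Φ : Matrix (Fin 3) (Fin 3) L))
    {γ : (UnitaryGroup.cmDatum L 3 (Φ : Matrix (Fin 3) (Fin 3) L)).Local v} (hγ : IsRegularElt (γ.val : GtLoc L v)) {y t t' : GtLoc L v}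
    (ht : t ∈ Subgroup.centralizer ({(γ.val : GtLoc L v)} : Set (GtLoc L v))) (hreg : IsEpsRegularAt L Φ v t)
    (h : y * t * (epsLoc L Φ v y)⁻¹ = t') (hN : epsNorm (epsLoc L Φ v) t = epsNorm (epsLoc L Φ v) t') :
    y ∈ Subgroup.centralizer ({(γ.val : GtLoc L v)} : Set (GtLoc L v)) := by
  have hcent : Subgroup.centralizer ({epsNorm (epsLoc L Φ v) t} : Set (GtLoc L v)) = Subgroup.centralizer {(γ.val : GtLoc L v)} :=
    centralizer_eq_centralizer_of_isRegularElt hγ ((isEpsRegularAt_iff L Φ v t).1 hreg) (epsNorm_mem_centralizer_coe γ ht)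
  rw [← hcent, Subgroup.mem_centralizer_singleton_iff]
  have hc := epsNorm_eq_conj_of_epsConj_eq hΦ h
  rw [← hN] at hc
  calc y * epsNorm (epsLoc L Φ v) t = y * epsNorm (epsLoc L Φ v) t * y⁻¹ * y := by group
    _ = epsNorm (epsLoc L Φ v) t * y := by rw [← hc]

variable {L Φ v} in
/-- **FIBRE LEMMA, coset form**: under the hypotheses of `mem_centralizer_of_epsConj_eq_of_epsNorm_eq`, `t′ = t · y ε(y)⁻¹` with `y ∈ T̃` — ε-conjugate points
over the same norm differ by an element of `(1−ε)T̃`. [cite: Rogawski1990, §3.11 Prop. 3.11.1 (c) p. 34; §12.5 p. 186] -/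
theorem eq_mul_mul_epsLoc_inv_of_epsConj_eq_of_epsNorm_eq
    (hΦ : ((Φ : GL (Fin 3) L) : Matrix (Fin 3) (Fin 3) L)ᵀ.map (IsCMField.complexConj L) = (Φ : Matrix (Fin 3) (Fin 3) L))
    {γ : (UnitaryGroup.cmDatum L 3 (Φ : Matrix (Fin 3) (Fin 3) L)).Local v} (hγ : IsRegularElt (γ.val : GtLoc L v)) {y t t' : GtLoc L v}
    (ht : t ∈ Subgroup.centralizer ({(γ.val : GtLoc L v)} : Set (GtLoc L v))) (hreg : IsEpsRegularAt L Φ v t)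
    (h : y * t * (epsLoc L Φ v y)⁻¹ = t') (hN : epsNorm (epsLoc L Φ v) t = epsNorm (epsLoc L Φ v) t') :
    y ∈ Subgroup.centralizer ({(γ.val : GtLoc L v)} : Set (GtLoc L v)) ∧ t' = t * (y * (epsLoc L Φ v y)⁻¹) := by
  have hy := mem_centralizer_of_epsConj_eq_of_epsNorm_eq hΦ hγ ht hreg h hN
  refine ⟨hy, ?_⟩
  rw [← h, mul_comm_of_mem_centralizer_of_isRegularElt hγ hy ht, mul_assoc]

variable {L Φ v} in
/-- **FIBRE LEMMA (normaliser form)**: for `γ` regular, `t, t′ ∈ T̃ = Cent(γ)` with `t` ε-regular and `y t ε(y)⁻¹ = t′`, conjugation by `y` preserves `T̃`: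
`h ∈ T̃ ↔ y⁻¹ h y ∈ T̃` (`T̃ = Cent(N t) = Cent(N t′)` and `N t′ = y (N t) y⁻¹`) — `y ∈ N_{G̃_v}(T̃)`, the twisted twin of ★
`Literature.MeasureTheory.Group.mem_normalizer_of_conj_eq`. [cite: Rogawski1990, §3.11 Prop. 3.11.2 pp. 34–35; §12.5 p. 186] -/
theorem mem_centralizer_iff_conj_mem_of_epsConj_eq
    (hΦ : ((Φ : GL (Fin 3) L) : Matrix (Fin 3) (Fin 3) L)ᵀ.map (IsCMField.complexConj L) = (Φ : Matrix (Fin 3) (Fin 3) L))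
    {γ : (UnitaryGroup.cmDatum L 3 (Φ : Matrix (Fin 3) (Fin 3) L)).Local v} (hγ : IsRegularElt (γ.val : GtLoc L v)) {y t t' : GtLoc L v}
    (ht : t ∈ Subgroup.centralizer ({(γ.val : GtLoc L v)} : Set (GtLoc L v))) (hreg : IsEpsRegularAt L Φ v t)
    (ht' : t' ∈ Subgroup.centralizer ({(γ.val : GtLoc L v)} : Set (GtLoc L v))) (h : y * t * (epsLoc L Φ v y)⁻¹ = t') (g : GtLoc L v) :
    g ∈ Subgroup.centralizer ({(γ.val : GtLoc L v)} : Set (GtLoc L v)) ↔ y⁻¹ * g * y ∈ Subgroup.centralizer ({(γ.val : GtLoc L v)} : Set (GtLoc L v)) := by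
  have hregN : IsRegularElt (epsNorm (epsLoc L Φ v) t) := (isEpsRegularAt_iff L Φ v t).1 hreg
  have hc := epsNorm_eq_conj_of_epsConj_eq hΦ h
  have hregN' : IsRegularElt (epsNorm (epsLoc L Φ v) t') := by
    rw [hc]
    exact (isRegularElt_conj_iff y _).2 hregN
  have hT : Subgroup.centralizer ({epsNorm (epsLoc L Φ v) t} : Set (GtLoc L v)) = Subgroup.centralizer {(γ.val : GtLoc L v)} :=
    centralizer_eq_centralizer_of_isRegularElt hγ hregN (epsNorm_mem_centralizer_coe γ ht)
  have hT' : Subgroup.centralizer ({epsNorm (epsLoc L Φ v) t'} : Set (GtLoc L v)) = Subgroup.centralizer {(γ.val : GtLoc L v)} :=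
    centralizer_eq_centralizer_of_isRegularElt hγ hregN' (epsNorm_mem_centralizer_coe γ ht')
  constructor
  · intro hg
    rw [← hT'] at hg
    rw [← hT, Subgroup.mem_centralizer_singleton_iff]
    rw [Subgroup.mem_centralizer_singleton_iff, hc] at hg
    calc y⁻¹ * g * y * epsNorm (epsLoc L Φ v) t = y⁻¹ * (g * (y * epsNorm (epsLoc L Φ v) t * y⁻¹)) * y := by group
      _ = y⁻¹ * (y * epsNorm (epsLoc L Φ v) t * y⁻¹ * g) * y := by rw [hg]
      _ = epsNorm (epsLoc L Φ v) t * (y⁻¹ * g * y) := by group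
  · intro hg
    rw [← hT, Subgroup.mem_centralizer_singleton_iff] at hg
    rw [← hT', Subgroup.mem_centralizer_singleton_iff, hc]
    calc g * (y * epsNorm (epsLoc L Φ v) t * y⁻¹) = y * (y⁻¹ * g * y * epsNorm (epsLoc L Φ v) t) * y⁻¹ := by group
      _ = y * (epsNorm (epsLoc L Φ v) t * (y⁻¹ * g * y)) * y⁻¹ := by rw [hg]
      _ = y * epsNorm (epsLoc L Φ v) t * y⁻¹ * g := by group

/-! ## §3 (A3) The norm fibre `S_γ = N⁻¹(γ)`: inside `T̃`, ε-absorbing, with `C_T`-cosets as ε-classes -/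

variable {L Φ v} in
/-- **`N t = γ ⇒ t ∈ T̃ = Cent(γ)`** (hermitian `Φ`, any `γ ∈ G_v`): `ε(N t) = ε(t) t`, and `ε(N t) = ε γ = γ = N t = t ε(t)`, so `t` and `ε(t)` commute and `t`
commutes with `N t = γ` — the norm fibre lies in the torus with no regularity needed. [cite: Rogawski1990, §3.11 Prop. 3.11.1 (b) p. 34] -/
theorem mem_centralizer_of_epsNorm_eq_coe
    (hΦ : ((Φ : GL (Fin 3) L) : Matrix (Fin 3) (Fin 3) L)ᵀ.map (IsCMField.complexConj L) = (Φ : Matrix (Fin 3) (Fin 3) L))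
    {γ : (UnitaryGroup.cmDatum L 3 (Φ : Matrix (Fin 3) (Fin 3) L)).Local v} {t : GtLoc L v} (ht : epsNorm (epsLoc L Φ v) t = γ.val) :
    t ∈ Subgroup.centralizer ({(γ.val : GtLoc L v)} : Set (GtLoc L v)) := by
  have hε : epsLoc L Φ v (epsLoc L Φ v t) = t := twistLocal_twistLocal_cm L 3 Φ hΦ v t
  have hNt : t * epsLoc L Φ v t = γ.val := ht
  have h1 : epsLoc L Φ v t * t = γ.val := by
    calc epsLoc L Φ v t * t = epsLoc L Φ v t * epsLoc L Φ v (epsLoc L Φ v t) := by rw [hε]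
      _ = epsLoc L Φ v (t * epsLoc L Φ v t) := by rw [map_mul]
      _ = γ.val := by rw [hNt, epsLoc_apply_coe]
  rw [Subgroup.mem_centralizer_singleton_iff]
  calc t * γ.val = t * (epsLoc L Φ v t * t) := by rw [h1]
    _ = t * epsLoc L Φ v t * t := by rw [mul_assoc]
    _ = γ.val * t := by rw [hNt]

variable {L Φ v} in
/-- **A point of the norm fibre over a regular `γ` is ε-regular** (`N t = γ` regular; ★ `isEpsRegularAt_iff`). [cite: Rogawski1990, §3.11 p. 34] -/
theorem isEpsRegularAt_of_epsNorm_eq_coe {γ : (UnitaryGroup.cmDatum L 3 (Φ : Matrix (Fin 3) (Fin 3) L)).Local v}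
    (hγ : IsRegularElt (γ.val : GtLoc L v)) {t : GtLoc L v} (ht : epsNorm (epsLoc L Φ v) t = γ.val) : IsEpsRegularAt L Φ v t := by
  rw [isEpsRegularAt_iff, ht]
  exact hγ

variable {L Φ v} in
/-- `N t = γ ⇒ γ ∈ 𝒩(t)` (★ `IsEpsNormPair`, by reflexivity of `IsConj`). [cite: Rogawski1990, §3.11 p. 34] -/
theorem isEpsNormPair_of_epsNorm_eq_coe {γ : (UnitaryGroup.cmDatum L 3 (Φ : Matrix (Fin 3) (Fin 3) L)).Local v} {t : GtLoc L v}
    (ht : epsNorm (epsLoc L Φ v) t = γ.val) : IsEpsNormPair L Φ v t γ := by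
  rw [isEpsNormPair_iff, ht]

variable {L Φ v} in
/-- **EVERY `δ` WITH `γ ∈ 𝒩(δ)` IS ε-CONJUGATE INTO THE NORM FIBRE `S_γ`** (hermitian `Φ`, any `γ ∈ G_v`): if `y (N δ) y⁻¹ = γ` then `t := y δ ε(y)⁻¹` has `N t = γ`
on the nose (★ `epsNorm_epsLoc_mul_mul_inv`) — so every ε-class whose norm class contains `γ` MEETS `T̃ = Cent(γ)` (with `mem_centralizer_of_epsNorm_eq_coe`):
print's «every stable ε-semisimple regular class intersects `T̃` for some `T`», classwise. [cite: Rogawski1990, §12.5 p. 186; §3.11 Prop. 3.11.1 (b) p. 34] -/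
theorem exists_isEpsConj_epsNorm_eq_coe_of_isEpsNormPair
    (hΦ : ((Φ : GL (Fin 3) L) : Matrix (Fin 3) (Fin 3) L)ᵀ.map (IsCMField.complexConj L) = (Φ : Matrix (Fin 3) (Fin 3) L))
    {γ : (UnitaryGroup.cmDatum L 3 (Φ : Matrix (Fin 3) (Fin 3) L)).Local v} {δ : GtLoc L v} (h : IsEpsNormPair L Φ v δ γ) :
    ∃ t : GtLoc L v, IsEpsConj (epsLoc L Φ v) δ t ∧ epsNorm (epsLoc L Φ v) t = γ.val := by
  obtain ⟨y, hy⟩ := isConj_iff.1 ((isEpsNormPair_iff δ γ).1 h)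
  exact ⟨y * δ * (epsLoc L Φ v y)⁻¹, ⟨y, rfl⟩, by rw [epsNorm_epsLoc_mul_mul_inv hΦ y δ, hy]⟩

variable {L Φ v} in
/-- **TWO POINTS OF THE NORM FIBRE OVER A REGULAR `γ` ARE ε-CONJUGATE IFF THEY DIFFER BY `(1−ε)T̃`**: for `N t = N t′ = γ` (`γ` regular, `Φ` hermitian),
`t ∼_ε t′ ↔ ∃ s ∈ T̃, t′ = t · s ε(s)⁻¹` (`⇒` §2; `⇐` §1, `T̃` abelian) — the ε-classes over `γ` are the `C_T`-cosets of `S_γ`: print's `𝒟_ε(δ∕F)` read inside the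
torus, `S_γ ∕ (1−ε)T̃`, a torsor under `T̃ᴺ ∕ (1−ε)T̃`. [cite: Rogawski1990, §3.11 Prop. 3.11.1 (c), Prop. 3.11.2 pp. 34–35; §12.5 p. 186] -/
theorem isEpsConj_iff_exists_mem_centralizer_of_epsNorm_eq_coe
    (hΦ : ((Φ : GL (Fin 3) L) : Matrix (Fin 3) (Fin 3) L)ᵀ.map (IsCMField.complexConj L) = (Φ : Matrix (Fin 3) (Fin 3) L))
    {γ : (UnitaryGroup.cmDatum L 3 (Φ : Matrix (Fin 3) (Fin 3) L)).Local v} (hγ : IsRegularElt (γ.val : GtLoc L v)) {t t' : GtLoc L v}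
    (ht : epsNorm (epsLoc L Φ v) t = γ.val) (ht' : epsNorm (epsLoc L Φ v) t' = γ.val) :
    IsEpsConj (epsLoc L Φ v) t t' ↔
      ∃ s ∈ Subgroup.centralizer ({(γ.val : GtLoc L v)} : Set (GtLoc L v)), t' = t * (s * (epsLoc L Φ v s)⁻¹) := by
  have htT := mem_centralizer_of_epsNorm_eq_coe hΦ ht
  constructor
  · rintro ⟨y, hy⟩
    obtain ⟨hyT, heq⟩ := eq_mul_mul_epsLoc_inv_of_epsConj_eq_of_epsNorm_eq hΦ hγ htT (isEpsRegularAt_of_epsNorm_eq_coe hγ ht) hy (ht.trans ht'.symm)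
    exact ⟨y, hyT, heq⟩
  · rintro ⟨s, hs, rfl⟩
    exact isEpsConj_mul_mul_epsLoc_inv_of_commute (mul_comm_of_mem_centralizer_of_isRegularElt hγ hs htT)

variable {L Φ v} in
/-- **The norm fibre is `(1−ε)T̃`-stable**: `N t = γ ⇒ N(t · s ε(s)⁻¹) = γ` for `s ∈ T̃` (`N` multiplicative on the abelian `T̃`, ★ `epsNorm_mul_of_mem_centralizer`;
`N(s ε(s)⁻¹) = 1`). [cite: Rogawski1990, §12.5 p. 186] -/
theorem epsNorm_mul_mul_epsLoc_inv_eq_coe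
    (hΦ : ((Φ : GL (Fin 3) L) : Matrix (Fin 3) (Fin 3) L)ᵀ.map (IsCMField.complexConj L) = (Φ : Matrix (Fin 3) (Fin 3) L))
    {γ : (UnitaryGroup.cmDatum L 3 (Φ : Matrix (Fin 3) (Fin 3) L)).Local v} (hγ : IsRegularElt (γ.val : GtLoc L v)) {t s : GtLoc L v}
    (ht : epsNorm (epsLoc L Φ v) t = γ.val) (hs : s ∈ Subgroup.centralizer ({(γ.val : GtLoc L v)} : Set (GtLoc L v))) :
    epsNorm (epsLoc L Φ v) (t * (s * (epsLoc L Φ v s)⁻¹)) = γ.val := by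
  have hsC : s * (epsLoc L Φ v s)⁻¹ ∈ Subgroup.centralizer ({(γ.val : GtLoc L v)} : Set (GtLoc L v)) :=
    Subgroup.mul_mem _ hs (Subgroup.inv_mem _ (epsLoc_mem_centralizer_coe γ hs))
  rw [epsNorm_mul_of_mem_centralizer hγ (mem_centralizer_of_epsNorm_eq_coe hΦ ht) hsC, epsNorm_mul_epsLoc_inv hΦ s, mul_one, ht]

/-! ## §4 (A3 on classes) The index set of the stable ε-orbital integral at `sec₀ γ` is the image of the norm fibre -/

variable {L Φ v} in
omit [IsCMField L] in
/-- **Two elements have the same ε-class (`mod ⊥`) iff they are ε-conjugate** (classes of ★ `EpsConjClassesMod ε ⊥` = the equivalence closure of ★ `epsConjModRel ε ⊥`,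
which IS ε-conjugacy: ★ `isEpsConj_of_eqvGen_epsConjModRel_bot`). [cite: Rogawski1990, §1.4 p. 4; §3.11 p. 35] -/
theorem epsConjClassesMod_mk_eq_mk_iff (ε : GtLoc L v →* GtLoc L v) (δ δ' : GtLoc L v) :
    (Quotient.mk (Relation.EqvGen.setoid (epsConjModRel ε ⊥)) δ : EpsConjClassesMod ε ⊥) =
        Quotient.mk (Relation.EqvGen.setoid (epsConjModRel ε ⊥)) δ' ↔ IsEpsConj ε δ δ' :=
  ⟨fun h => isEpsConj_of_eqvGen_epsConjModRel_bot ε (Quotient.exact h), fun h => Quotient.sound (Relation.EqvGen.rel _ _ (Or.inl h))⟩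

variable {L Φ v} in
/-- **Stable ε-conjugacy to `δ₀` IS «`γ` is a norm»** when `γ ∈ 𝒩(δ₀)`: `IsStablyEpsConjAt … δ₀ δ ↔ IsEpsNormPair … δ γ` (both say `N δ ~ γ`; ★ `isStablyEpsConjAt_iff`,
transitivity of `IsConj`). [cite: Rogawski1990, §3.11 Prop. 3.11.1 (c) p. 34] -/
theorem isStablyEpsConjAt_iff_isEpsNormPair {γ : (UnitaryGroup.cmDatum L 3 (Φ : Matrix (Fin 3) (Fin 3) L)).Local v} {δ₀ : GtLoc L v}
    (hδ₀ : IsEpsNormPair L Φ v δ₀ γ) (δ : GtLoc L v) : IsStablyEpsConjAt L Φ v δ₀ δ ↔ IsEpsNormPair L Φ v δ γ := by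
  rw [isStablyEpsConjAt_iff, isEpsNormPair_iff]
  rw [isEpsNormPair_iff] at hδ₀
  exact ⟨fun h => h.symm.trans hδ₀, fun h => hδ₀.trans h.symm⟩

variable {L Φ v} in
/-- **THE INDEX SET OF `Φ^{st}_ε(δ₀, ·)` IS THE IMAGE OF THE NORM FIBRE** (hermitian `Φ`, any `γ ∈ 𝒩(δ₀)`): an ε-class `c` is stably ε-conjugate to `δ₀` iff
`c = ⟦t⟧` for some `t` with `N t = γ` ON THE NOSE — `{c | IsStablyEpsConjAt … δ₀ (out c)} = ⟦·⟧ '' {t | N t = γ}`, the set over which ★ `stableEpsOrbitalIntegral_eq_finsum`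
sums; by §3 its points are the `(1−ε)T̃`-cosets of the fibre. [cite: Rogawski1990, §4.10 (4.10.1) p. 57; §3.11 Prop. 3.11.1 (b)(c) pp. 34–35; §12.5 p. 186] -/
theorem setOf_isStablyEpsConjAt_out_eq_image_normFibre
    (hΦ : ((Φ : GL (Fin 3) L) : Matrix (Fin 3) (Fin 3) L)ᵀ.map (IsCMField.complexConj L) = (Φ : Matrix (Fin 3) (Fin 3) L))
    {γ : (UnitaryGroup.cmDatum L 3 (Φ : Matrix (Fin 3) (Fin 3) L)).Local v} {δ₀ : GtLoc L v} (hδ₀ : IsEpsNormPair L Φ v δ₀ γ) :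
    {c : EpsConjClassesMod (epsLoc L Φ v) ⊥ | IsStablyEpsConjAt L Φ v δ₀ (Quotient.out c)} =
      Quotient.mk (Relation.EqvGen.setoid (epsConjModRel (epsLoc L Φ v) ⊥)) '' {t : GtLoc L v | epsNorm (epsLoc L Φ v) t = γ.val} := by
  ext c
  refine ⟨fun hc => ?_, ?_⟩
  · obtain ⟨t, hct, ht⟩ :=
      exists_isEpsConj_epsNorm_eq_coe_of_isEpsNormPair hΦ ((isStablyEpsConjAt_iff_isEpsNormPair hδ₀ (Quotient.out c)).1 hc)
    refine ⟨t, ht, ?_⟩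
    rw [← Quotient.out_eq c, epsConjClassesMod_mk_eq_mk_iff]
    exact isEpsConj_symm hct
  · rintro ⟨t, ht : epsNorm (epsLoc L Φ v) t = γ.val, rfl⟩
    exact (isStablyEpsConjAt_iff_isEpsNormPair hδ₀ _).2
      (isEpsNormPair_of_isEpsConj hΦ (isEpsNormPair_of_epsNorm_eq_coe ht) (isEpsConj_symm (isEpsConj_out_mk (epsLoc L Φ v) t)))

variable {L Φ v} in
/-- **… and on the fibre, `⟦t⟧ = ⟦t′⟧ ↔ t′ ∈ t · (1−ε)T̃`** (regular `γ`): the parametrisation of the index set of `Φ^{st}_ε(sec₀ γ, ·)` by `N⁻¹(γ) ∕ (1−ε)T̃`.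
[cite: Rogawski1990, §3.11 Prop. 3.11.1 (c) p. 34; §12.5 p. 186] -/
theorem epsConjClassesMod_mk_eq_mk_iff_of_epsNorm_eq_coe
    (hΦ : ((Φ : GL (Fin 3) L) : Matrix (Fin 3) (Fin 3) L)ᵀ.map (IsCMField.complexConj L) = (Φ : Matrix (Fin 3) (Fin 3) L))
    {γ : (UnitaryGroup.cmDatum L 3 (Φ : Matrix (Fin 3) (Fin 3) L)).Local v} (hγ : IsRegularElt (γ.val : GtLoc L v)) {t t' : GtLoc L v}
    (ht : epsNorm (epsLoc L Φ v) t = γ.val) (ht' : epsNorm (epsLoc L Φ v) t' = γ.val) :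
    (Quotient.mk (Relation.EqvGen.setoid (epsConjModRel (epsLoc L Φ v) ⊥)) t : EpsConjClassesMod (epsLoc L Φ v) ⊥) =
        Quotient.mk (Relation.EqvGen.setoid (epsConjModRel (epsLoc L Φ v) ⊥)) t' ↔
      ∃ s ∈ Subgroup.centralizer ({(γ.val : GtLoc L v)} : Set (GtLoc L v)), t' = t * (s * (epsLoc L Φ v s)⁻¹) := by
  rw [epsConjClassesMod_mk_eq_mk_iff, isEpsConj_iff_exists_mem_centralizer_of_epsNorm_eq_coe hΦ hγ ht ht']

variable {L Φ v} in
/-- **EVERY ε-CLASS OVER `γ` HAS A REPRESENTATIVE IN `T̃` WITH NORM EXACTLY `γ`, and its chosen representative `out c` is ε-conjugate to it** — the form in which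
T-WIF's torus variable (`t ∈ T̃`, `N t = γ`) reads the summands `Φ_ε(out c, φ)` of `Φ^{st}_ε(sec₀ γ, φ)` (ε-orbital integrals are ε-class functions for an
ε-canonical family, ★ p863195). [cite: Rogawski1990, §12.5 p. 186; §4.10 (4.10.1) p. 57] -/
theorem exists_epsNorm_eq_coe_isEpsConj_out_of_isStablyEpsConjAt
    (hΦ : ((Φ : GL (Fin 3) L) : Matrix (Fin 3) (Fin 3) L)ᵀ.map (IsCMField.complexConj L) = (Φ : Matrix (Fin 3) (Fin 3) L))
    {γ : (UnitaryGroup.cmDatum L 3 (Φ : Matrix (Fin 3) (Fin 3) L)).Local v} {δ₀ : GtLoc L v} (hδ₀ : IsEpsNormPair L Φ v δ₀ γ)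
    {c : EpsConjClassesMod (epsLoc L Φ v) ⊥} (hc : IsStablyEpsConjAt L Φ v δ₀ (Quotient.out c)) :
    ∃ t : GtLoc L v, epsNorm (epsLoc L Φ v) t = γ.val ∧ t ∈ Subgroup.centralizer ({(γ.val : GtLoc L v)} : Set (GtLoc L v)) ∧
      IsEpsConj (epsLoc L Φ v) (Quotient.out c) t ∧ Quotient.mk (Relation.EqvGen.setoid (epsConjModRel (epsLoc L Φ v) ⊥)) t = c := by
  obtain ⟨t, hct, ht⟩ := exists_isEpsConj_epsNorm_eq_coe_of_isEpsNormPair hΦ ((isStablyEpsConjAt_iff_isEpsNormPair hδ₀ _).1 hc)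
  refine ⟨t, ht, mem_centralizer_of_epsNorm_eq_coe hΦ ht, hct, ?_⟩
  rw [← Quotient.out_eq c, epsConjClassesMod_mk_eq_mk_iff]
  exact isEpsConj_symm hct

end NormFibre

end Summit.HodgeConjecture.HodgeConjecture.R90.S4

end
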